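import Mathlib

/-!
# The Fine-number law — combinatorial core (W3 / pub-hsemireg, seat w3-prym-2 g6)

Honest framing: nothing here says HC / HC_CM / HC_AV is proved.  This file is the
kernel-checked leg of the purely combinatorial part of the note `W3-DPFINE-w3prym2.md`
(v1.1, §3 steps (2)–(6)).  The intersection-theoretic inputs of the THEOREM-DP recipe
(Macdonald's Chern class of a symmetric product, the Poincaré formula, the class of the
canonical series, the norm-map pull-back rule, Fulton's double-point formula) are NOT
formalised here; what is formalised is every finite identity that turns those inputs into
the closed form

  `δ_d = 3^{d-2} (C(2d,d) + 2(-1)^d) - 3^{d-1} a_d = 2 · 3^{d-2} (F_{d-1} + (-1)^d)`,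

where `a_d = Σ_{n=0}^{d} C(2d,n) (-2)^{d-n}` is the truncated binomial sum to which the
normal-bundle integral collapses and `F` are the Fine numbers (OEIS A000957), defined here
by their standard recurrence `2 F_{n+1} + F_n = C_{n+1}`, `F_0 = 1` (`C_n` = Catalan).

Contents (step (2), the binomial evaluation `Σ_i C(s,i)(-3)^{s-i} = (-2)^s`, is already in the
tree as `Summit.Ventures.HSemireg.SchoenCarrierDeltaClosedForm.choose_mul_neg_three_pow_sum`
and is not restated here): the
alternating sum `Σ_{k ≤ d} (-1)^k C(d+1,k) = (-1)^d` (step (3), the surviving `m = 0`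
term — the vanishing for `m ≥ 1` is Mathlib's `Int.alternating_sum_range_choose_of_ne`);
the first-order recurrence `2 a_{d+1} + a_d = 2 C(2d,d+1) + C(2d,d)` of the truncated
sum (Pascal's rule twice plus truncation bookkeeping); the identity
`C(2e+2,e+1) - C(2e,e) - 3 C(2e,e+1) = C_e`; and the law
`C(2d,d) - 3 a_d = 2 F_{d-1}` (`d ≥ 1`) by induction, with its `δ`-form corollary.
-/

namespace Summit.Ventures.HSemireg.FineLaw

open Finset

/-- Step (3) of the note, the surviving term: `Σ_{k=0}^{d} (-1)^k C(d+1,k) = (-1)^d`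
(the full alternating row sum minus its last term). -/
theorem alternating_sum_choose_succ_trunc (d : ℕ) :
    ∑ k ∈ range (d + 1), (-1 : ℤ) ^ k * ((d + 1).choose k : ℤ) = (-1) ^ d := by
  have h := (Int.alternating_sum_range_choose_eq_choose (n := d) (m := d))
  simpa using h

/-- The truncated binomial polynomial `P N t y = Σ_{n=0}^{t} C(N,n) yⁿ`. -/
def P (N t : ℕ) (y : ℚ) : ℚ := ∑ n ∈ range (t + 1), ((N.choose n : ℕ) : ℚ) * y ^ n

/-- Raising the truncation point by one. -/
theorem P_succ_right (N t : ℕ) (y : ℚ) :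
    P N (t + 1) y = P N t y + ((N.choose (t + 1) : ℕ) : ℚ) * y ^ (t + 1) := by
  unfold P
  rw [sum_range_succ]

/-- Pascal's rule for the truncated binomial polynomial:
`P (N+1) t y = (1+y) P N t y - C(N,t) y^{t+1}`. -/
theorem P_succ_left (N t : ℕ) (y : ℚ) :
    P (N + 1) t y = (1 + y) * P N t y - ((N.choose t : ℕ) : ℚ) * y ^ (t + 1) := by
  unfold P
  rw [sum_range_succ' (fun n => (((N + 1).choose n : ℕ) : ℚ) * y ^ n)]
  have h3 : ∀ n, (((N + 1).choose (n + 1) : ℕ) : ℚ) * y ^ (n + 1)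
      = ((N.choose n : ℕ) : ℚ) * y ^ (n + 1) + ((N.choose (n + 1) : ℕ) : ℚ) * y ^ (n + 1) := by
    intro n
    rw [Nat.choose_succ_succ']
    push_cast
    ring
  simp only [h3, sum_add_distrib, Nat.choose_zero_right, Nat.cast_one, pow_zero, mul_one]
  have h1 : ∑ n ∈ range t, ((N.choose (n + 1) : ℕ) : ℚ) * y ^ (n + 1) + 1
      = ∑ n ∈ range (t + 1), ((N.choose n : ℕ) : ℚ) * y ^ n := by
    rw [sum_range_succ' (fun n => ((N.choose n : ℕ) : ℚ) * y ^ n)]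
    simp
  have h2 : ∑ n ∈ range t, ((N.choose n : ℕ) : ℚ) * y ^ (n + 1)
      = y * ∑ n ∈ range (t + 1), ((N.choose n : ℕ) : ℚ) * y ^ n
        - ((N.choose t : ℕ) : ℚ) * y ^ (t + 1) := by
    rw [sum_range_succ, mul_add, mul_sum]
    have h4 : ∀ n, y * (((N.choose n : ℕ) : ℚ) * y ^ n) = ((N.choose n : ℕ) : ℚ) * y ^ (n + 1) := by
      intro n
      ring
    simp only [h4]
    ring
  linear_combination h2 + h1

/-- The truncated sum of the note, `a_d = Σ_{n=0}^{d} C(2d,n) (-2)^{d-n}` (an integer;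
`a_1 … a_7 = 0, 2, 6, 22, 80, 296, 1106`); `c_d(N_u) = 3^{d-1} a_d`. -/
def truncSum (d : ℕ) : ℤ := ∑ n ∈ range (d + 1), (((2 * d).choose n : ℕ) : ℤ) * (-2) ^ (d - n)

/-- Sanity values `a_1, a_2, a_3, a_4 = 0, 2, 6, 22`. -/
theorem truncSum_values : truncSum 1 = 0 ∧ truncSum 2 = 2 ∧ truncSum 3 = 6 ∧ truncSum 4 = 22 := by
  refine ⟨?_, ?_, ?_, ?_⟩ <;> decide

/-- `a_d = (-2)^d · P_{2d}(d)(-1/2)`. -/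
theorem truncSum_eq_P (d : ℕ) : (truncSum d : ℚ) = (-2 : ℚ) ^ d * P (2 * d) d (-1 / 2) := by
  unfold truncSum P
  push_cast
  rw [mul_sum]
  refine sum_congr rfl fun n hn => ?_
  have hn' : n ≤ d := Nat.lt_succ_iff.mp (mem_range.mp hn)
  obtain ⟨k, rfl⟩ := Nat.exists_eq_add_of_le hn'
  rw [Nat.add_sub_cancel_left, pow_add]
  have hXY : (-2 : ℚ) ^ n * (-1 / 2) ^ n = 1 := by
    rw [← mul_pow]
    norm_num
  linear_combination (-(((2 * (n + k)).choose n : ℕ) : ℚ) * (-2 : ℚ) ^ k) * hXY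

/-- The first-order recurrence of the truncated sum (rational form):
`2 a_{d+1} + a_d = 2 C(2d,d+1) + C(2d,d)`. -/
theorem truncSum_rec_rat (d : ℕ) :
    2 * (truncSum (d + 1) : ℚ) + (truncSum d : ℚ)
      = 2 * (((2 * d).choose (d + 1) : ℕ) : ℚ) + (((2 * d).choose d : ℕ) : ℚ) := by
  rw [truncSum_eq_P, truncSum_eq_P, show 2 * (d + 1) = 2 * d + 1 + 1 by ring,
    P_succ_left, P_succ_left, P_succ_right]
  have hC : (((2 * d + 1).choose (d + 1) : ℕ) : ℚ)
      = (((2 * d).choose d : ℕ) : ℚ) + (((2 * d).choose (d + 1) : ℕ) : ℚ) := by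
    rw [Nat.choose_succ_succ']
    push_cast
    rfl
  have hXY : (-2 : ℚ) ^ d * (-1 / 2) ^ d = 1 := by
    rw [← mul_pow]
    norm_num
  simp only [pow_succ]
  linear_combination ((((2 * d).choose (d + 1) : ℕ) : ℚ) + (((2 * d + 1).choose (d + 1) : ℕ) : ℚ)) * hXY + hC

/-- The first-order recurrence of the truncated sum (integer form):
`2 a_{d+1} + a_d = 2 C(2d,d+1) + C(2d,d)`. -/
theorem truncSum_rec (d : ℕ) :
    2 * truncSum (d + 1) + truncSum d = 2 * (((2 * d).choose (d + 1) : ℕ) : ℤ) + (((2 * d).choose d : ℕ) : ℤ) := by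
  have h := truncSum_rec_rat d
  exact_mod_cast h

/-- The Fine numbers (OEIS A000957) as rationals, by their standard recurrence
`2 F_{n+1} + F_n = C_{n+1}`, `F_0 = 1`: `1, 0, 1, 2, 6, 18, 57, 186, …`. -/
def fine : ℕ → ℚ
  | 0 => 1
  | n + 1 => ((catalan (n + 1) : ℕ) - fine n) / 2

/-- The defining recurrence `2 F_{n+1} + F_n = C_{n+1}`. -/
theorem two_mul_fine_succ_add (n : ℕ) : 2 * fine (n + 1) + fine n = (catalan (n + 1) : ℕ) := by
  rw [fine]
  ring

/-- Sanity values `F_1 … F_5 = 0, 1, 2, 6, 18`. -/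
theorem fine_values : fine 1 = 0 ∧ fine 2 = 1 ∧ fine 3 = 2 ∧ fine 4 = 6 ∧ fine 5 = 18 := by
  have c1 : catalan 1 = 1 := by
    norm_num [catalan_eq_centralBinom_div, Nat.centralBinom_eq_two_mul_choose, Nat.choose]
  have c2 : catalan 2 = 2 := by
    norm_num [catalan_eq_centralBinom_div, Nat.centralBinom_eq_two_mul_choose, Nat.choose]
  have c3 : catalan 3 = 5 := by
    norm_num [catalan_eq_centralBinom_div, Nat.centralBinom_eq_two_mul_choose, Nat.choose]
  have c4 : catalan 4 = 14 := by
    norm_num [catalan_eq_centralBinom_div, Nat.centralBinom_eq_two_mul_choose, Nat.choose]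
  have c5 : catalan 5 = 42 := by
    norm_num [catalan_eq_centralBinom_div, Nat.centralBinom_eq_two_mul_choose, Nat.choose]
  simp only [fine, c1, c2, c3, c4, c5]
  norm_num

/-- `C(2e+2,e+1) - C(2e,e) - 3 C(2e,e+1) = C_e` (Catalan), the identity that matches the
truncated-sum recurrence with the Fine recurrence. -/
theorem choose_identity (e : ℕ) :
    (((2 * (e + 1)).choose (e + 1) : ℕ) : ℚ) - (((2 * e).choose e : ℕ) : ℚ)
      - 3 * (((2 * e).choose (e + 1) : ℕ) : ℚ) = ((catalan e : ℕ) : ℚ) := by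
  have hA0 := Nat.succ_mul_centralBinom_succ e
  rw [Nat.centralBinom_eq_two_mul_choose, Nat.centralBinom_eq_two_mul_choose] at hA0
  have hA : ((e : ℚ) + 1) * (((2 * (e + 1)).choose (e + 1) : ℕ) : ℚ)
      = 2 * (2 * (e : ℚ) + 1) * (((2 * e).choose e : ℕ) : ℚ) := by
    exact_mod_cast hA0
  have hB0 := Nat.choose_succ_right_eq (2 * e) e
  rw [show 2 * e - e = e by omega] at hB0
  have hB : (((2 * e).choose (e + 1) : ℕ) : ℚ) * ((e : ℚ) + 1)
      = (((2 * e).choose e : ℕ) : ℚ) * (e : ℚ) := by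
    exact_mod_cast hB0
  have hC0 := _root_.succ_mul_catalan_eq_centralBinom e
  rw [Nat.centralBinom_eq_two_mul_choose] at hC0
  have hC : ((e : ℚ) + 1) * ((catalan e : ℕ) : ℚ) = (((2 * e).choose e : ℕ) : ℚ) := by
    exact_mod_cast hC0
  have he : ((e : ℚ) + 1) ≠ 0 := by positivity
  apply mul_left_cancel₀ he
  linear_combination hA - 3 * hB - hC

/-- THE FINE-NUMBER LAW (combinatorial core): for every `d ≥ 0`,
`C(2(d+1), d+1) - 3 a_{d+1} = 2 F_d`, i.e. `c_{d'}(N_u) = 3^{d'-1} a_{d'} =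
3^{d'-2} (C(2d',d') - 2 F_{d'-1})` for `d' = d+1 ≥ 1`. -/
theorem fine_law (d : ℕ) :
    (((2 * (d + 1)).choose (d + 1) : ℕ) : ℚ) - 3 * (truncSum (d + 1) : ℚ) = 2 * fine d := by
  induction d with
  | zero =>
    have h1 : truncSum 1 = 0 := by decide
    have h2 : (2 * (0 + 1)).choose (0 + 1) = 2 := by decide
    rw [h1, h2, fine]
    norm_num
  | succ d ih =>
    have hrec := truncSum_rec_rat (d + 1)
    have hfine := two_mul_fine_succ_add d
    have hid := choose_identity (d + 1)
    linear_combination (-3 / 2 : ℚ) * hrec - (1 / 2 : ℚ) * ih - hfine + hid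

/-- THE FINE-NUMBER LAW in the note's `δ`-form: for `d' = d+2 ≥ 2`,
`δ_{d'} := 3^{d'-2} (C(2d',d') + 2(-1)^{d'}) - 3^{d'-1} a_{d'} = 2·3^{d'-2} (F_{d'-1} + (-1)^{d'})`
(`δ_2 … δ_9 = 2, 0, 54, 270, 3078, 27216, 272646`; `δ_{d'} = 0 ⟺ d' ∈ {1,3}`). -/
theorem fine_number_law (d : ℕ) :
    (3 : ℚ) ^ d * ((((2 * (d + 2)).choose (d + 2) : ℕ) : ℚ) + 2 * (-1) ^ (d + 2))
        - 3 ^ (d + 1) * (truncSum (d + 2) : ℚ)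
      = 2 * 3 ^ d * (fine (d + 1) + (-1) ^ (d + 2)) := by
  have h := fine_law (d + 1)
  linear_combination (3 : ℚ) ^ d * h

end Summit.Ventures.HSemireg.FineLaw
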